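import Literature.Analysis.FluidPDE.LerayProfileCalculus
import Literature.Analysis.FluidPDE.VectorCalculusProofs
import Literature.Analysis.FluidPDE.WholeSpaceIBP
import Literature.Analysis.FluidPDE.RadialCalculus
import Literature.Analysis.FluidPDE.TaoEnstrophyLocalisation
import Literature.Analysis.FluidPDE.WeightedVelocityBounds
import HarnessLib

/-!
# A sphere-Hodge lemma on `(EuclideanSpace ℝ (Fin 3))`, I: tangency calculus and two radial integral identities

Support file for item `stmt-NavierStokesRegularity-1365` (`SphereTangentLiouville`, route
`CorkscrewDynamo`, NavierStokesRegularity). The last step of the toroidal anti-dynamo argument: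
a `C²` vector field `V` on `(EuclideanSpace ℝ (Fin 3))` which is tangent to the spheres about the origin (`⟪x, V x⟫ = 0`),
divergence free, and whose curl is also tangent to those spheres (`⟪x, curl V x⟫ = 0`) vanishes
identically. On each sphere `V` is a surface-divergence-free and surface-curl-free tangent field,
i.e. a harmonic 1-form on `S²`, hence zero; we give a self-contained proof by a weighted Bochner
identity on the whole space, with no surface measure:

* `inner_fderiv_apply_of_tangent` — tangency differentiated: `⟪x, DV(x) h⟫ = −⟪h, V x⟫`;
* `norm_sub_adjoint_apply_sq_add` — Lagrange's identity for the spin matrix,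
  `‖(L − Lᵀ) x‖² + ⟪x, curl L⟫² = ‖curl L‖² ‖x‖²`;
* `norm_curl_sq_mul_norm_sq_of_tangent` — hence `‖curl V x‖² ‖x‖² = ‖DV(x) x + V x‖²` when
  `⟪x, curl V x⟫ = 0`;
* `integral_radial_mul_traceCLM` — `∫ ψ(|x|²) tr(DV DV) = ∫ 2ψ'(|x|²)‖V‖²`
  (from `div((V·∇)V) = tr(DV DV)` for divergence-free `V`);
* `integral_radial_fderiv_norm_sq` — the radial integration by parts
  `∫ η(|x|²) D(‖V‖²)(x)[x] = −∫ (3η + 2|x|²η')(|x|²) ‖V‖²`.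

This file holds the pointwise algebra and the two integral identities (tools); the Bochner identity
and the lemma itself are in `CorkscrewDynamoSphereTangentLiouvilleHodge.lean`.
-/

noncomputable section

open MeasureTheory Set Function Filter InnerProductSpace
open scoped RealInnerProductSpace Topology
open Literature.Analysis Literature.Analysis.FluidPDE

set_option linter.dupNamespace false

namespace Summit.NavierStokesRegularity.NavierStokesRegularity.Theorems

section Tangent

variable {E : Type*} [NormedAddCommGroup E] [InnerProductSpace ℝ E]

/-- **Tangency differentiated.** If `⟪x, V x⟫ = 0` for all `x` and `V` is differentiable at `x`,
then `⟪x, DV(x) h⟫ = −⟪h, V x⟫` for every direction `h` (i.e. `DV(x)ᵀ x = −V x`). -/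
theorem inner_fderiv_apply_of_tangent {V : E → E} (hT : ∀ x, ⟪x, V x⟫ = 0)
    {x : E} (hV : DifferentiableAt ℝ V x) (h : E) :
    ⟪x, fderiv ℝ V x h⟫ = -⟪h, V x⟫ := by
  have hzero : (fun y : E => ⟪y, V y⟫) = fun _ => (0 : ℝ) := funext hT
  have h1 : fderiv ℝ (fun y : E => ⟪y, V y⟫) x h = 0 := by
    rw [hzero, fderiv_fun_const]
    rfl
  have h2 := fderiv_inner_apply ℝ (f := fun y : E => y) (g := V) differentiableAt_id hV h
  rw [h1, fderiv_fun_id] at h2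
  simp only [ContinuousLinearMap.coe_id', id_eq] at h2
  linarith

/-- A field tangent to the spheres about the origin vanishes at the origin (differentiate the
tangency at `0`). -/
theorem apply_zero_eq_zero_of_tangent {V : E → E} (hT : ∀ x, ⟪x, V x⟫ = 0)
    (hV : DifferentiableAt ℝ V 0) : V 0 = 0 := by
  have h := inner_fderiv_apply_of_tangent hT hV (V 0)
  rw [inner_zero_left] at h
  have : ⟪V 0, V 0⟫ = 0 := by linarith
  exact inner_self_eq_zero.1 this

/-- With tangency, the adjoint of the velocity gradient sends `x` to `−V x`. -/
theorem adjoint_fderiv_apply_of_tangent [CompleteSpace E] {V : E → E} (hT : ∀ x, ⟪x, V x⟫ = 0)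
    {x : E} (hV : DifferentiableAt ℝ V x) :
    ContinuousLinearMap.adjoint (fderiv ℝ V x) x = -V x := by
  refine ext_inner_right ℝ fun h => ?_
  rw [ContinuousLinearMap.adjoint_inner_left, inner_fderiv_apply_of_tangent hT hV h,
    inner_neg_left, real_inner_comm]

end Tangent

/-! ### Lagrange's identity for the spin matrix -/

/-- **Lagrange's identity for the spin matrix.** For a linear map `L` of `(EuclideanSpace ℝ (Fin 3))` and `x ∈ (EuclideanSpace ℝ (Fin 3))`, with
`ω = curlCLM L` the curl vector of `L` (so that `(L − Lᵀ) h = ω × h`),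
`‖(L − Lᵀ) x‖² + ⟪x, ω⟫² = ‖ω‖² ‖x‖²` (expand in coordinates and `ring`). -/
theorem norm_sub_adjoint_apply_sq_add (L : (EuclideanSpace ℝ (Fin 3)) →L[ℝ] (EuclideanSpace ℝ (Fin 3))) (x : (EuclideanSpace ℝ (Fin 3))) :
    ‖(L - ContinuousLinearMap.adjoint L) x‖ ^ 2 + ⟪x, curlCLM L⟫ ^ 2 =
      ‖curlCLM L‖ ^ 2 * ‖x‖ ^ 2 := by
  -- matrix entries `(L eⱼ) k`, `eⱼ = EuclideanSpace.single j 1`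
  set e : Fin 3 → (EuclideanSpace ℝ (Fin 3)) := fun i => EuclideanSpace.single i 1 with he
  have hx : x = ∑ j, x j • e j := by
    conv_lhs => rw [← (EuclideanSpace.basisFun (Fin 3) ℝ).sum_repr' x]
    refine Finset.sum_congr rfl fun j _ => ?_
    rw [EuclideanSpace.basisFun_apply, EuclideanSpace.inner_single_left]
    simp [he]
  -- coordinates of `L x`
  have hLx : ∀ k : Fin 3, L x k = ∑ j, x j * L (e j) k := by
    intro k
    conv_lhs => rw [hx]
    rw [map_sum]
    simp [map_smul]
  -- coordinates of `Lᵀ x`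
  have hadj : ∀ k : Fin 3, (ContinuousLinearMap.adjoint L x) k = ∑ j, x j * L (e k) j := by
    intro k
    have h1 : ⟪e k, ContinuousLinearMap.adjoint L x⟫ = (ContinuousLinearMap.adjoint L x) k := by
      simp [he, EuclideanSpace.inner_single_left]
    rw [← h1, ContinuousLinearMap.adjoint_inner_right, PiLp.inner_apply]
    simp
  -- coordinates of the curl vector
  have hc0 : curlCLM L 0 = L (e 1) 2 - L (e 2) 1 := rfl
  have hc1 : curlCLM L 1 = L (e 2) 0 - L (e 0) 2 := rfl
  have hc2 : curlCLM L 2 = L (e 0) 1 - L (e 1) 0 := rfl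
  -- expand everything
  have hn1 : ‖(L - ContinuousLinearMap.adjoint L) x‖ ^ 2 =
      ∑ k, (L x k - (ContinuousLinearMap.adjoint L x) k) ^ 2 := by
    rw [EuclideanSpace.norm_sq_eq]
    refine Finset.sum_congr rfl fun k _ => ?_
    rw [Real.norm_eq_abs, sq_abs]
    rfl
  have hn2 : ‖curlCLM L‖ ^ 2 = ∑ k, (curlCLM L k) ^ 2 := by
    rw [EuclideanSpace.norm_sq_eq]
    exact Finset.sum_congr rfl fun k _ => by rw [Real.norm_eq_abs, sq_abs]
  have hn3 : ‖x‖ ^ 2 = ∑ k, (x k) ^ 2 := by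
    rw [EuclideanSpace.norm_sq_eq]
    exact Finset.sum_congr rfl fun k _ => by rw [Real.norm_eq_abs, sq_abs]
  have hi : ⟪x, curlCLM L⟫ = ∑ k, x k * curlCLM L k := by
    rw [PiLp.inner_apply]
    simp [mul_comm]
  rw [hn1, hn2, hn3, hi]
  simp only [Fin.sum_univ_three, hLx, hadj, hc0, hc1, hc2]
  ring

/-- **`‖curl V x‖² ‖x‖² = ‖DV(x) x + V x‖²`** for a field tangent to the spheres about the origin
whose curl is tangent at `x`. -/
theorem norm_curl_sq_mul_norm_sq_of_tangent {V : (EuclideanSpace ℝ (Fin 3)) → (EuclideanSpace ℝ (Fin 3))} (hT : ∀ x, ⟪x, V x⟫ = 0)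
    {x : (EuclideanSpace ℝ (Fin 3))} (hV : DifferentiableAt ℝ V x) (hC : ⟪x, curl V x⟫ = 0) :
    ‖curl V x‖ ^ 2 * ‖x‖ ^ 2 = ‖fderiv ℝ V x x + V x‖ ^ 2 := by
  have h := norm_sub_adjoint_apply_sq_add (fderiv ℝ V x) x
  have e1 : (fderiv ℝ V x - ContinuousLinearMap.adjoint (fderiv ℝ V x)) x = fderiv ℝ V x x + V x := by
    rw [_root_.sub_apply, adjoint_fderiv_apply_of_tangent hT hV, sub_neg_eq_add]
  rw [← curl_eq_curlCLM, hC, e1] at h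
  simpa using h.symm

/-! ### Radial test functions -/

section Radial

variable {E : Type*} [NormedAddCommGroup E] [InnerProductSpace ℝ E] [FiniteDimensional ℝ E]

/-- A compactly supported profile `ψ` gives a compactly supported radial function `ψ(‖·‖²)`. -/
theorem hasCompactSupport_comp_norm_sq {ψ : ℝ → ℝ} (hψ : HasCompactSupport ψ) :
    HasCompactSupport fun x : E => ψ (‖x‖ ^ 2) := by
  haveI : ProperSpace E := FiniteDimensional.proper ℝ E
  obtain ⟨R, hR⟩ := hψ.isCompact.isBounded.subset_closedBall 0
  refine HasCompactSupport.of_support_subset_isCompact (isCompact_closedBall (0 : E) (Real.sqrt R))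
    fun x hx => ?_
  have hx' : ‖x‖ ^ 2 ∈ tsupport ψ := subset_tsupport ψ (mem_support.2 (mem_support.1 hx))
  have hR' : ‖x‖ ^ 2 ≤ R := by
    have := hR hx'
    rw [Metric.mem_closedBall, dist_zero_right, Real.norm_eq_abs, abs_of_nonneg (sq_nonneg _)] at this
    exact this
  rw [Metric.mem_closedBall, dist_zero_right]
  exact Real.le_sqrt_of_sq_le hR'

omit [FiniteDimensional ℝ E] in
/-- `x ↦ ψ(‖x‖²)` is `Cⁿ` for `ψ ∈ Cⁿ`. -/
theorem contDiff_comp_norm_sq {ψ : ℝ → ℝ} {n : ℕ∞} (hψ : ContDiff ℝ n ψ) :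
    ContDiff ℝ n fun x : E => ψ (‖x‖ ^ 2) :=
  hψ.comp (contDiff_norm_sq ℝ)

omit [FiniteDimensional ℝ E] in
/-- `D(ψ(‖·‖²))(x) h = 2 ψ'(‖x‖²) ⟪x, h⟫` for `ψ ∈ C¹`. -/
theorem fderiv_comp_norm_sq_apply' {ψ : ℝ → ℝ} (hψ : ContDiff ℝ 1 ψ) (x h : E) :
    fderiv ℝ (fun y : E => ψ (‖y‖ ^ 2)) x h = 2 * deriv ψ (‖x‖ ^ 2) * ⟪x, h⟫ :=
  fderiv_comp_norm_sq_apply ((hψ.differentiable one_ne_zero) _).hasDerivAt h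

end Radial

/-! ### The two integral identities -/

section Integral

variable {E : Type*} [NormedAddCommGroup E] [InnerProductSpace ℝ E] [FiniteDimensional ℝ E]
  [MeasurableSpace E] [BorelSpace E]

/-- **`∫ ψ(|x|²) tr(DV DV) = ∫ 2ψ'(|x|²) ‖V‖²`** for a `C²` divergence-free field tangent to the
spheres about the origin and a compactly supported `C¹` profile `ψ`: integrate
`div(ψ(|x|²) (V·∇)V) = ψ(|x|²) tr(DV DV) + 2ψ'(|x|²)⟪x, DV(x) V x⟫` over the whole space and use
`⟪x, DV(x) V x⟫ = −‖V x‖²` (tangency). -/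
theorem integral_radial_mul_traceCLM {V : E → E} (hV : ContDiff ℝ 2 V)
    (hdiv : VectorCalculus.IsDivFree V) (hT : ∀ x, ⟪x, V x⟫ = 0)
    {ψ : ℝ → ℝ} (hψ : ContDiff ℝ 1 ψ) (hψc : HasCompactSupport ψ) :
    ∫ x, ψ (‖x‖ ^ 2) * traceCLM ((fderiv ℝ V x).comp (fderiv ℝ V x)) =
      ∫ x, 2 * deriv ψ (‖x‖ ^ 2) * ‖V x‖ ^ 2 := by
  have hφ1 : ContDiff ℝ 1 fun x : E => ψ (‖x‖ ^ 2) := contDiff_comp_norm_sq hψ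
  have hφc : HasCompactSupport fun x : E => ψ (‖x‖ ^ 2) := hasCompactSupport_comp_norm_sq hψc
  have hV1 : ContDiff ℝ 1 V := hV.of_le one_le_two
  have hVd : ∀ x, DifferentiableAt ℝ V x := fun x => hV1.differentiable one_ne_zero x
  -- the field `ψ(|x|²) • (V·∇)V` is `C¹` with compact support, so its divergence integrates to zero
  have hZ : ContDiff ℝ 1 fun y => fderiv ℝ V y (V y) :=
    (hV.fderiv_right (m := 1) le_rfl).clm_apply hV1
  have hfield : (fun y => ψ (‖y‖ ^ 2) • (fderiv ℝ V y (V y) - VectorCalculus.divergence V y • V y)) =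
      fun y => ψ (‖y‖ ^ 2) • fderiv ℝ V y (V y) := by
    funext y
    rw [hdiv y, zero_smul, sub_zero]
  have hint0 := integral_divergence_eq_zero (w := fun y => ψ (‖y‖ ^ 2) • fderiv ℝ V y (V y))
    (hφ1.smul hZ) (hφc.smul_right (f' := fun y => fderiv ℝ V y (V y)))
  -- pointwise form of the divergence
  have hpt : ∀ x, VectorCalculus.divergence (fun y => ψ (‖y‖ ^ 2) • fderiv ℝ V y (V y)) x =
      ψ (‖x‖ ^ 2) * traceCLM ((fderiv ℝ V x).comp (fderiv ℝ V x)) -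
        2 * deriv ψ (‖x‖ ^ 2) * ‖V x‖ ^ 2 := by
    intro x
    have key := divergence_smul_convect_sub V hV hφ1 x
    rw [hfield] at key
    rw [key, hdiv x, zero_smul, sub_zero, fderiv_comp_norm_sq_apply' hψ,
      inner_fderiv_apply_of_tangent hT (hVd x), real_inner_self_eq_norm_sq]
    ring
  simp_rw [hpt] at hint0
  -- integrability
  have hc1 : Continuous fun x => ψ (‖x‖ ^ 2) * traceCLM ((fderiv ℝ V x).comp (fderiv ℝ V x)) :=
    hφ1.continuous.mul (traceCLM.continuous.comp
      (((hV1.continuous_fderiv one_ne_zero)).clm_comp (hV1.continuous_fderiv one_ne_zero)))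
  have hi1 : Integrable (fun x => ψ (‖x‖ ^ 2) * traceCLM ((fderiv ℝ V x).comp (fderiv ℝ V x))) := by
    refine hc1.integrable_of_hasCompactSupport (hφc.mono fun x hx => ?_)
    simp only [mem_support, ne_eq, mul_eq_zero, not_or] at hx ⊢
    exact hx.1
  have hc2 : Continuous fun x : E => 2 * deriv ψ (‖x‖ ^ 2) * ‖V x‖ ^ 2 :=
    (continuous_const.mul ((hψ.continuous_deriv le_rfl).comp (continuous_norm.pow 2))).mul
      (hV.continuous.norm.pow 2)
  have hi2 : Integrable (fun x : E => 2 * deriv ψ (‖x‖ ^ 2) * ‖V x‖ ^ 2) := by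
    refine hc2.integrable_of_hasCompactSupport
      ((hasCompactSupport_comp_norm_sq (E := E) hψc.deriv).mono fun x hx => ?_)
    simp only [mem_support, ne_eq, mul_eq_zero, not_or] at hx ⊢
    exact hx.1.2
  rw [integral_sub hi1 hi2] at hint0
  linarith

/-- **Radial integration by parts**: for `V ∈ C¹` and a compactly supported `C¹` profile `η`,
`∫ η(|x|²) D(‖V‖²)(x)[x] = −∫ (d η(|x|²) + 2|x|² η'(|x|²)) ‖V x‖²`, `d = dim E` (integrate
`div(‖V‖² η(|x|²) x) = 0`). -/
theorem integral_radial_fderiv_norm_sq {V : E → E} (hV : ContDiff ℝ 1 V)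
    {η : ℝ → ℝ} (hη : ContDiff ℝ 1 η) (hηc : HasCompactSupport η) :
    ∫ x, η (‖x‖ ^ 2) * fderiv ℝ (fun y => ‖V y‖ ^ 2) x x =
      -∫ x, ((Module.finrank ℝ E : ℝ) * η (‖x‖ ^ 2) + 2 * ‖x‖ ^ 2 * deriv η (‖x‖ ^ 2)) *
        ‖V x‖ ^ 2 := by
  have hφ1 : ContDiff ℝ 1 fun x : E => η (‖x‖ ^ 2) := contDiff_comp_norm_sq hη
  have hφc : HasCompactSupport fun x : E => η (‖x‖ ^ 2) := hasCompactSupport_comp_norm_sq hηc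
  have hθ : ContDiff ℝ 1 fun y => ‖V y‖ ^ 2 := hV.norm_sq ℝ
  have hu : ContDiff ℝ 1 fun x : E => η (‖x‖ ^ 2) • x := hφ1.smul contDiff_id
  have huc : HasCompactSupport fun x : E => η (‖x‖ ^ 2) • x :=
    hφc.smul_right (f' := fun x : E => x)
  have key := integral_mul_divergence_add_eq_zero_right hθ hu huc
  -- pointwise: the divergence of `η(|x|²) • x` and the pairing with the gradient
  have hdivu : ∀ x : E, VectorCalculus.divergence (fun y : E => η (‖y‖ ^ 2) • y) x =
      (Module.finrank ℝ E : ℝ) * η (‖x‖ ^ 2) + 2 * ‖x‖ ^ 2 * deriv η (‖x‖ ^ 2) := by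
    intro x
    rw [divergence_smul_apply (hφ1.differentiable one_ne_zero x) differentiableAt_fun_id,
      divergence_id_eq_finrank, gradient, real_inner_comm, InnerProductSpace.toDual_symm_apply,
      fderiv_comp_norm_sq_apply' hη, real_inner_self_eq_norm_sq]
    ring
  have hgrad : ∀ x : E, ⟪η (‖x‖ ^ 2) • x, gradient (fun y => ‖V y‖ ^ 2) x⟫ =
      η (‖x‖ ^ 2) * fderiv ℝ (fun y => ‖V y‖ ^ 2) x x := by
    intro x
    rw [real_inner_smul_left, gradient, real_inner_comm, InnerProductSpace.toDual_symm_apply]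
  simp_rw [hdivu, hgrad] at key
  have h1 : ∫ x, ‖V x‖ ^ 2 * ((Module.finrank ℝ E : ℝ) * η (‖x‖ ^ 2) +
      2 * ‖x‖ ^ 2 * deriv η (‖x‖ ^ 2)) =
      ∫ x, ((Module.finrank ℝ E : ℝ) * η (‖x‖ ^ 2) + 2 * ‖x‖ ^ 2 * deriv η (‖x‖ ^ 2)) *
        ‖V x‖ ^ 2 :=
    integral_congr_ae (Eventually.of_forall fun x => mul_comm _ _)
  linarith

end Integral

end Summit.NavierStokesRegularity.NavierStokesRegularity.Theorems
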